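import Summits.CriticalPhenomena.PercolationContinuityZ3.Theorems.PercNearOneGluingNoHeavyLowerTailQuantitativeS5PocketZeroSet
import HarnessLib

/-!
# The exact PEELING IDENTITY of the (S5D) margin at the rank-maximal relay, and the matching split of the explicit floor

Support file (`--supports stmt-CriticalPhenomena-4575`), prover seat `prim-rate-mine-2` (lane prim-rate, constants-miner (c), BENCH row
M2-R41; `run/shared/lean/prim/prim-rate/prim-rate-mine-2/PROOFS.md` §P2, §P41).  No definitions, no named facts, no sorries; standard axioms.

Weights `< 1`; relays `T` with an injective rank `r`, rank-maximal relay `k`, `T' = T ∖ k`; decoys `D`; observers `o, v`; ANY functional `F`.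
With `A_k = {k ↮ T'}`, `F̂_k(C) = F({k} ∪ ⋃ C)`, `c_k = avoidConst w k T'`, `p = obsConst w o v (T ∪ D)`:

* `CSH.s5dMargin_peel_top` — **`μ(A_k)·s5dMargin w T r D o v F = μ(A_k)·s5dMargin w T' r (k :: D) o v F + cshMargin w k T' D o v F̂_k
  + rankGain w T r F k · μ(A_k) · cshMarg (decoyList w T D) p o v c_k`** — the identity inside the induction of `CSH.s5dMargin_nonneg_of_csh`
  (Lemma P `CSH.surplus_erase_add`, `CSH.covD_clusterFun_eq`, Lemma R `CSH.cshMarg_cons`, Lemma κ `CSH.rankGain_top_eq`), exported as an equation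
  (no monotonicity, no compatibility);
* `CSH.floor_split_top` — the explicit floor with a general decoy list (`Σ_a γ_a q_a + ∏(1 − w)·Cov_{w_{T<a}}(F(V 𝒞_a), 1{o ↔ {a} ∪ T_{>a} ∪ D ∨ o ↔ v})`,
  for `D = []` verbatim the floor of `CSH.s5dMargin_ge_sum_rankGain_add_isolatedFloor_of_lt_one_of_compat`) splits as its `k`-summand plus the floor
  of `(T', k :: D)` (`CSH.rankGain_erase_top`: the peeled relay becomes a decoy of every lower level).
[cite: KozmaNitzan2024, Conj. 4 (p. 32), Lemma 2 (p. 6)] [cite: VandenbergHaggstromKahn2005, Thm. 1.3 (p. 6)]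
-/

noncomputable section

namespace Summit.CriticalPhenomena.PercolationContinuityZ3.Theorems

open MeasureTheory Set Literature.Probability.LatticeModels Literature.Probability.Percolation
open scoped Classical
open KNPreFKG

namespace CSH

variable {n : ℕ}

/-- **The exact peeling identity at the rank-maximal relay.**  Weights `< 1`; `k ∈ T` rank-maximal for the injective rank `r`, `T' = T ∖ k`:
`μ(A_k)·M(T; D) = μ(A_k)·M(T'; k :: D) + cshMargin w k T' D o v F̂_k + γ_k·μ(A_k)·Marg[c_k]` — for every functional `F`.
[cite: KozmaNitzan2024, Conj. 4 (p. 32), Lemma 2 (p. 6)] -/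
theorem s5dMargin_peel_top (w : Sym2 (Fin n) → unitInterval) (hw : ∀ e, w e < 1) (T : Finset (Fin n)) (r : Fin n → ℕ)
    (D : List (Fin n)) (F : Set (Fin n) → ℝ) (o v k : Fin n) (hkT : k ∈ T) (hr : Set.InjOn r ↑T) (hkmax : ∀ a ∈ T, r a ≤ r k) :
    (prodBernoulli w).real {ω : BondConfig (Fin n) | ∀ a ∈ (↑(T.erase k) : Set (Fin n)), ¬ (openGraph ω).Reachable k a} *
        s5dMargin w T r D o v F =
      (prodBernoulli w).real {ω : BondConfig (Fin n) | ∀ a ∈ (↑(T.erase k) : Set (Fin n)), ¬ (openGraph ω).Reachable k a} *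
          s5dMargin w (T.erase k) r (k :: D) o v F +
        cshMargin w k (↑(T.erase k) : Set (Fin n)) D o v (fun C => F {a | a = k ∨ ∃ e ∈ C, a ∈ e}) +
        rankGain w T r F k *
            (prodBernoulli w).real {ω : BondConfig (Fin n) | ∀ a ∈ (↑(T.erase k) : Set (Fin n)), ¬ (openGraph ω).Reachable k a} *
          cshMarg (decoyList w (↑T : Set (Fin n)) D) (obsConst w o v ((↑T : Set (Fin n)) ∪ {d | d ∈ D})) o v
            (avoidConst w k (↑(T.erase k) : Set (Fin n))) := by
  set μ := prodBernoulli w with hμ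
  have hmeas : ∀ S : Set (BondConfig (Fin n)), MeasurableSet S := fun _ => MeasurableSet.of_discrete
  set T' : Finset (Fin n) := T.erase k with hT'
  have hT'T : ∀ a ∈ T', a ∈ T := fun a ha => Finset.mem_of_mem_erase ha
  have hkT' : k ∉ T' := Finset.notMem_erase k T
  have hlt : ∀ a ∈ T', r a < r k := by
    intro a ha
    rcases (hkmax a (hT'T a ha)).lt_or_eq with h | h
    · exact h
    · exact absurd (hr (hT'T a ha) hkT h) (Finset.ne_of_mem_erase ha)
  -- the objects
  set Dk : Set (BondConfig (Fin n)) := {ω : BondConfig (Fin n) | ∀ a ∈ (↑T' : Set (Fin n)), ¬ (openGraph ω).Reachable k a} with hDk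
  set mk : ℝ := ∫ ω, F (openCluster ω k) ∂μ with hmk
  set κ : ℝ := mk * μ.real Dk - ∫ ω in Dk, F (openCluster ω k) ∂μ with hκ
  set L := decoyList w (↑T : Set (Fin n)) D with hL
  set p : ℝ := obsConst w o v ((↑T : Set (Fin n)) ∪ {d | d ∈ D}) with hp
  set ck : Fin n → ℝ := avoidConst w k (↑T' : Set (Fin n)) with hck
  set Fh : Set (Sym2 (Fin n)) → ℝ := fun C => F {a | a = k ∨ ∃ e ∈ C, a ∈ e} with hFh
  set Tk : Fin n → ℝ := fun u => (∫ ω in Dk ∩ openConn k u, F (openCluster ω k) ∂μ) - μ.real (Dk ∩ openConn k u) * mk with hTk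
  have hempty_Dk : (∅ : BondConfig (Fin n)) ∈ Dk := by
    intro a ha h
    rw [HullPort.reachable_empty_iff] at h
    exact hkT' (h ▸ (Finset.mem_coe.1 ha))
  have hDkpos : 0 < μ.real Dk := prodBernoulli_real_pos_of_empty_mem w hw hempty_Dk
  -- set identities between the systems `(T; D)`, `(T'; k; D)` and `(T'; k :: D)`
  have hins : insert k (↑T' : Set (Fin n)) = ↑T := by
    rw [hT', Finset.coe_erase, insert_sdiff_singleton, insert_eq_of_mem (Finset.mem_coe.2 hkT)]
  have hset2 : (↑T' : Set (Fin n)) ∪ {d | d ∈ k :: D} = (↑T : Set (Fin n)) ∪ {d | d ∈ D} := by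
    ext a
    simp only [mem_union, Finset.mem_coe, hT', Finset.mem_erase, mem_setOf_eq, List.mem_cons]
    constructor
    · rintro (⟨_, ha⟩ | rfl | ha)
      · exact Or.inl ha
      · exact Or.inl hkT
      · exact Or.inr ha
    · rintro (ha | ha)
      · by_cases hak : a = k
        · exact Or.inr (Or.inl hak)
        · exact Or.inl ⟨hak, ha⟩
      · exact Or.inr (Or.inr ha)
  have hcshMargin : ∀ f : Set (Sym2 (Fin n)) → ℝ,
      cshMargin w k (↑T' : Set (Fin n)) D o v f = cshMarg L p o v (covD w k (↑T' : Set (Fin n)) f) := by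
    intro f
    rw [cshMargin, hins]
  have hnext : s5dMargin w T' r (k :: D) o v F =
      cshMarg L p o v (surplus w T' r F) - surplus w T' r F k * cshMarg L p o v ck := by
    rw [s5dMargin, hset2, decoyList, hins, cshMarg_cons]
  -- Lemma P: peel `k`
  have hpeel : surplus w T r F = (surplus w T' r F) + Tk := by
    funext u
    rw [Pi.add_apply, surplus_erase_add w T r F hkT hlt u]
  -- the top-relay term through `covD`
  have hTk_cov : (μ.real Dk) • Tk = covD w k (↑T' : Set (Fin n)) Fh - (κ * μ.real Dk) • ck := by
    funext u
    simp only [Pi.smul_apply, Pi.sub_apply, smul_eq_mul]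
    have h1 := covD_clusterFun_eq w T' F k u
    have h2 : μ.real (Dk ∩ openConn k u) = μ.real Dk * ck u := by
      simp only [hck, avoidConst, hDk]
      rw [mul_div_cancel₀ _ (ne_of_gt hDkpos)]
    simp only [hTk, hFh, hκ, hmk, hDk] at h1 h2 ⊢
    rw [h1, h2]
    ring
  have hmain : μ.real Dk * s5dMargin w T r D o v F =
      μ.real Dk * cshMarg L p o v (surplus w T' r F) + cshMarg L p o v (covD w k (↑T' : Set (Fin n)) Fh) -
        κ * μ.real Dk * cshMarg L p o v ck := by
    have e1 : μ.real Dk * cshMarg L p o v Tk =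
        cshMarg L p o v (covD w k (↑T' : Set (Fin n)) Fh) - κ * μ.real Dk * cshMarg L p o v ck := by
      rw [← cshMarg_smul, hTk_cov, cshMarg_sub, cshMarg_smul]
    rw [s5dMargin, ← hL, ← hp, hpeel, cshMarg_add, mul_add, e1]
    ring
  -- Lemma κ: the slack is the rank gain
  have hγ : rankGain w T r F k = surplus w T' r F k - κ := by
    rw [rankGain_top_eq w T r F k hkT hr hkmax]
  rw [hmain, hnext, hcshMargin, hγ]
  ring

/-- **The floor splits at the rank-maximal relay.**  `k ∈ T` rank-maximal for the injective rank `r`, `T' = T ∖ k`: the explicit floor of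
`(T; D)` is its `k`-summand plus the floor of `(T'; k :: D)` — the rank gains of the lower relays are unchanged (`CSH.rankGain_erase_top`) and
the peeled relay becomes a decoy of every lower level. [cite: KozmaNitzan2024, Conj. 4 (p. 32)] -/
theorem floor_split_top (w : Sym2 (Fin n) → unitInterval) (T : Finset (Fin n)) (r : Fin n → ℕ) (D : List (Fin n))
    (F : Set (Fin n) → ℝ) (o v k : Fin n) (hkT : k ∈ T) (hr : Set.InjOn r ↑T) (hkmax : ∀ a ∈ T, r a ≤ r k) :
    ∑ a ∈ T, (rankGain w T r F a * avoidConst w a ((↑(T.erase a) : Set (Fin n)) ∪ ({d | d ∈ D} ∪ {v})) o +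
        (∏ e ∈ Finset.univ.filter (fun e : Sym2 (Fin n) => ∃ y ∈ (↑(T.filter (fun b => r b < r a)) : Set (Fin n)), y ∈ e), (1 - (w e : ℝ))) *
          ((∫ η in ((⋃ t ∈ (insert a (T.filter (fun b => r a < r b) ∪ (D).toFinset)), openConn o t) ∪ openConn o v),
              F {c | c = a ∨ ∃ e ∈ openEdgeCluster η a, c ∈ e}
              ∂(prodBernoulli fun e => if (∃ y ∈ (↑(T.filter (fun b => r b < r a)) : Set (Fin n)), y ∈ e) then (0 : unitInterval) else w e)) -
            (prodBernoulli fun e => if (∃ y ∈ (↑(T.filter (fun b => r b < r a)) : Set (Fin n)), y ∈ e) then (0 : unitInterval) else w e).real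
                ((⋃ t ∈ (insert a (T.filter (fun b => r a < r b) ∪ (D).toFinset)), openConn o t) ∪ openConn o v) *
              (∫ η, F {c | c = a ∨ ∃ e ∈ openEdgeCluster η a, c ∈ e}
                ∂(prodBernoulli fun e => if (∃ y ∈ (↑(T.filter (fun b => r b < r a)) : Set (Fin n)), y ∈ e) then (0 : unitInterval) else w e)))) =
      (rankGain w T r F k * avoidConst w k ((↑(T.erase k) : Set (Fin n)) ∪ ({d | d ∈ D} ∪ {v})) o +
        (∏ e ∈ Finset.univ.filter (fun e : Sym2 (Fin n) => ∃ y ∈ (↑(T.filter (fun b => r b < r k)) : Set (Fin n)), y ∈ e), (1 - (w e : ℝ))) *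
          ((∫ η in ((⋃ t ∈ (insert k (T.filter (fun b => r k < r b) ∪ (D).toFinset)), openConn o t) ∪ openConn o v),
              F {c | c = k ∨ ∃ e ∈ openEdgeCluster η k, c ∈ e}
              ∂(prodBernoulli fun e => if (∃ y ∈ (↑(T.filter (fun b => r b < r k)) : Set (Fin n)), y ∈ e) then (0 : unitInterval) else w e)) -
            (prodBernoulli fun e => if (∃ y ∈ (↑(T.filter (fun b => r b < r k)) : Set (Fin n)), y ∈ e) then (0 : unitInterval) else w e).real
                ((⋃ t ∈ (insert k (T.filter (fun b => r k < r b) ∪ (D).toFinset)), openConn o t) ∪ openConn o v) *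
              (∫ η, F {c | c = k ∨ ∃ e ∈ openEdgeCluster η k, c ∈ e}
                ∂(prodBernoulli fun e => if (∃ y ∈ (↑(T.filter (fun b => r b < r k)) : Set (Fin n)), y ∈ e) then (0 : unitInterval) else w e)))) +
      ∑ a ∈ (T.erase k), (rankGain w (T.erase k) r F a * avoidConst w a ((↑((T.erase k).erase a) : Set (Fin n)) ∪ ({d | d ∈ (k :: D)} ∪ {v})) o +
        (∏ e ∈ Finset.univ.filter (fun e : Sym2 (Fin n) => ∃ y ∈ (↑((T.erase k).filter (fun b => r b < r a)) : Set (Fin n)), y ∈ e), (1 - (w e : ℝ))) *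
          ((∫ η in ((⋃ t ∈ (insert a ((T.erase k).filter (fun b => r a < r b) ∪ ((k :: D)).toFinset)), openConn o t) ∪ openConn o v),
              F {c | c = a ∨ ∃ e ∈ openEdgeCluster η a, c ∈ e}
              ∂(prodBernoulli fun e => if (∃ y ∈ (↑((T.erase k).filter (fun b => r b < r a)) : Set (Fin n)), y ∈ e) then (0 : unitInterval) else w e)) -
            (prodBernoulli fun e => if (∃ y ∈ (↑((T.erase k).filter (fun b => r b < r a)) : Set (Fin n)), y ∈ e) then (0 : unitInterval) else w e).real
                ((⋃ t ∈ (insert a ((T.erase k).filter (fun b => r a < r b) ∪ ((k :: D)).toFinset)), openConn o t) ∪ openConn o v) *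
              (∫ η, F {c | c = a ∨ ∃ e ∈ openEdgeCluster η a, c ∈ e}
                ∂(prodBernoulli fun e => if (∃ y ∈ (↑((T.erase k).filter (fun b => r b < r a)) : Set (Fin n)), y ∈ e) then (0 : unitInterval) else w e)))) := by
  set T' : Finset (Fin n) := T.erase k with hT'
  have hT'T : ∀ a ∈ T', a ∈ T := fun a ha => Finset.mem_of_mem_erase ha
  have hkT' : k ∉ T' := Finset.notMem_erase k T
  have hlt : ∀ a ∈ T', r a < r k := by
    intro a ha
    rcases (hkmax a (hT'T a ha)).lt_or_eq with h | h
    · exact h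
    · exact absurd (hr (hT'T a ha) hkT h) (Finset.ne_of_mem_erase ha)
  have hfa : ∀ a ∈ T', T.filter (fun t => r t < r a) = T'.filter (fun t => r t < r a) := by
    intro a ha
    ext t
    rw [Finset.mem_filter, Finset.mem_filter, hT', Finset.mem_erase]
    constructor
    · rintro ⟨ht, hlt'⟩
      refine ⟨⟨fun h => ?_, ht⟩, hlt'⟩
      rw [h] at hlt'
      exact lt_irrefl _ ((hlt a ha).trans hlt')
    · rintro ⟨⟨_, ht⟩, hlt'⟩
      exact ⟨ht, hlt'⟩
  have hfa' : ∀ a ∈ T', insert a (T.filter (fun t => r a < r t) ∪ D.toFinset) =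
      insert a (T'.filter (fun t => r a < r t) ∪ (k :: D).toFinset) := by
    intro a ha
    ext t
    simp only [Finset.mem_insert, Finset.mem_union, Finset.mem_filter, List.mem_toFinset, List.mem_cons, hT', Finset.mem_erase]
    constructor
    · rintro (h | ⟨ht, hlt'⟩ | h)
      · exact Or.inl h
      · by_cases htk : t = k
        · exact Or.inr (Or.inr (Or.inl htk))
        · exact Or.inr (Or.inl ⟨⟨htk, ht⟩, hlt'⟩)
      · exact Or.inr (Or.inr (Or.inr h))
    · rintro (h | ⟨⟨_, ht⟩, hlt'⟩ | rfl | h)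
      · exact Or.inl h
      · exact Or.inr (Or.inl ⟨ht, hlt'⟩)
      · exact Or.inr (Or.inl ⟨hkT, hlt a ha⟩)
      · exact Or.inr (Or.inr h)
  have havoid : ∀ a ∈ T', ((↑(T.erase a) : Set (Fin n)) ∪ ({d | d ∈ D} ∪ {v})) =
      ((↑(T'.erase a) : Set (Fin n)) ∪ ({d | d ∈ k :: D} ∪ {v})) := by
    intro a ha
    ext t
    simp only [mem_union, Finset.mem_coe, Finset.mem_erase, hT', mem_setOf_eq, List.mem_cons, mem_singleton_iff]
    constructor
    · rintro (⟨hta, ht⟩ | h | h)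
      · by_cases htk : t = k
        · exact Or.inr (Or.inl (Or.inl htk))
        · exact Or.inl ⟨hta, htk, ht⟩
      · exact Or.inr (Or.inl (Or.inr h))
      · exact Or.inr (Or.inr h)
    · rintro (⟨hta, _, ht⟩ | (rfl | h) | h)
      · exact Or.inl ⟨hta, ht⟩
      · exact Or.inl ⟨fun h => hkT' (h ▸ ha), hkT⟩
      · exact Or.inr (Or.inl h)
      · exact Or.inr (Or.inr h)
  rw [← Finset.add_sum_erase T _ hkT, ← hT']
  congr 1
  refine Finset.sum_congr rfl fun a ha => ?_
  rw [rankGain_erase_top w T r F k a ha hkmax hr hkT, havoid a ha, hfa a ha, hfa' a ha]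

end CSH

end Summit.CriticalPhenomena.PercolationContinuityZ3.Theorems

end
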